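import Literature.MathematicalPhysics.QuantumFieldTheory.CCHS2024.OrbitSpace3D
import Literature.MathematicalPhysics.QuantumFieldTheory.CCHS2024.OrbitMarkov2D
import HarnessLib

/-!
# Chandra–Chevyrev–Hairer–Shen: generative probability measures and the Markov process on the
# space of gauge orbits `𝔒̂ = 𝒮/∼ ⊔ {☠}` in 3D (Invent. Math. 237 (2024), §7: Def. 7.1, Def. 7.2, Thm 7.5)

Cross-ladder literature typing (R141 (D) item (5), sixth file; venue `CCHS2024/`). STATEMENTS ONLY —
hypothesis-free definitions and the printed theorem as a named `Prop`; nothing here is a claim about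
the Yang–Mills mass gap. The 3D analogue of `OrbitMarkov2D.lean`, built on `YMH3D.lean` (state space
`(𝒮, Σ)` on heat data, the SPDE (1.14), `𝒮^sol`, the mollified white noise) and `OrbitSpace3D.lean`
(the orbit relation `∼`, `OrbitRel3`); **pure Yang–Mills** throughout (R14). Source: A. Chandra,
I. Chevyrev, M. Hairer, H. Shen, *Stochastic quantisation of Yang–Mills–Higgs in 3D*, Invent. Math.
237 (2024) 541–696, arXiv:2201.03487 (held `paper:arxiv-2201.03487`; bib `ChandraEtAl2024`).
**Numbering** (by counting the numbered environments of §7 in the held text, as in `OrbitSpace3D.lean`):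
Def 7.1 (white noise, admissible filtration, the SYMH solution map `Λ`), Def 7.2 (generative,
`def:gen`), Rem 7.3–7.4, Thm 7.5 (`thm:Markov_process`), Prop 7.6 (`prop:gauge_covar_couple`),
Rem 7.7, Lemma 7.8; Thm 1.9 (ii) of the introduction announces Thm 7.5.

## The printed statements (pure YM)

* **Def. 7.1.** A white noise `ξ` on `ℝ × 𝕋³` on `(𝒪, 𝓕, 𝐏)`; `(𝓕_t)` admissible (`ξ` adapted,
  `ξ↾[t,∞)` independent of `𝓕_t`); the SYMH solution map `Λ : {0 ≤ s ≤ t} × 𝒮̂ → 𝒮̂`, the `ε → 0` limit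
  of (1.14) with a mollifier `χ` and `C^ε_𝔄 = C^ε_YM + Č`, `Č` the unique `χ`-independent operator of the
  gauge-covariance theorem (footnote: a.s. defined simultaneously for all `x`, `s ≤ t`; independent of
  `χ`); `t ↦ Λ_{s,s+t}(x) ∈ 𝒮^sol` a.s. `X ∼ ☠ :⇔ X = ☠`. Fix `η̄ ∈ (η,−½)`, `δ̄ ∈ (¾,δ)` with
  `β < −2(1−δ̄)−`, `ᾱ ∈ (α,½)`; `Σ̄ = Σ_{η̄,β,δ̄,ᾱ,θ}`.
* **Def. 7.2 (generative).** A probability measure `μ` on `D(ℝ_+, 𝒮̂)` is generative if there are a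
  filtered probability space with a white noise and admissible filtration and a `D(ℝ_+,𝒮̂)`-valued
  random variable `X` with: (1) `Law(X) = μ`, `X(0)` `𝓕_0`-measurable; (2) non-decreasing stopping times
  `ς_0 = 0 ≤ ς_1 ≤ …` with (a) `X(t) = Λ_{ς_j,t}(X(ς_j))` for `t ∈ [ς_j, ς_{j+1})`, (b) `X(ς_{j+1})`
  `𝓕_{ς_{j+1}}`-measurable and `X(ς_{j+1}) ∼ Λ_{ς_j,ς_{j+1}}(X(ς_j))`; (3) with `T* = inf{t ≥ 0 : X(t) = ☠}`:
  a.s. `ς_j → T*`, and on `{T* < ∞}` a.s. `lim_{t↑T*} Σ(X(t),0) = ∞`, `X ≡ ☠` on `[T*,∞)`, and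
  `lim_{t↑T*} inf_{Y ∈ 𝒮, Y ∼ X(t)} Σ̄(Y,0) = ∞`. Initial condition `x` if `X(0) = x` a.s.
* **Thm 7.5.** (i) For every `x ∈ 𝒮̂` there exists a generative `μ` with initial condition `x`.
  (ii) For every `z ∈ 𝔒̂` there is a (necessarily unique) probability measure `P^z` on `C(ℝ_+, 𝔒̂)` with
  `π_*μ = P^z` for every `x ∈ z` and generative `μ` with initial condition `x`; `{P^z}_{z∈𝔒̂}` are the
  transition functions of a time-homogeneous Markov process on `𝔒̂`. (Before the theorem: `π_*μ` is a
  probability measure on `C(ℝ_+, 𝔒̂)`; `𝔒̂` carries the quotient topology, Prop 2.53.)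

## What is typed (print → Lean)

* Ball-generated σ-algebras `hatSigmaBorel3` (on `𝒮̂`), `sigmaBorel3` (on `𝒮`); `IsCadlagPath3`
  (`D(ℝ_+, 𝒮̂)`), `blowUpTime3`, `atTime3`, `hatSigmaSize` (`Σ(·,0)`, `∞` at `☠`), `HatOrbitRel3`
  (`∼` on `𝒮̂`), `IsBarParams` (`Σ̄`'s parameters), `orbitInfSigma3` (`inf_{Y ∼ X} Σ̄(Y,0)`);
  `noiseSigma3` / `futureNoiseSigma3` / `IsAdmissibleFiltration3` (R17 with the time-support radius of
  the compactly supported 3D mollifier as an index); `IsYMRenormalisation` (the Theorem 1.7 property of a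
  family `C^{χ,ε}_YM`, = the body of `localExistence3D`, as a predicate); `IsLimitFlowFrom3`
  (`Λ_{σ,·}(B)` at a stopping time, R16); **`IsGenerative3`** (Def. 7.2); saturated Borel sets and
  cylinders of the projected process (`IsSaturatedBorel3`, `InSatSet`, `satCylinder`); the fact
  **`markovProcessOnOrbits3D`** (Thm 7.5 (i) + (ii)).

## Renderings (recorded for the reviewer)

* (R8), (R12)–(R18) of the sibling files apply: the noise through its mollifications; heat data; laws of
  `𝔒̂`-valued processes through cylinder probabilities; the solution map at random data as the `ε → 0`
  limit in probability of restarted mollified solutions (R16 — in 3D print's footnote to Def. 7.1 makes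
  `Λ^o_{s,t}(x)` simultaneously defined for all `x, s ≤ t`, so evaluating at `(ς_j, X(ς_j))` is
  literal). Since `𝔒` is completely Hausdorff but not metrisable (Prop 2.51, Rem 2.52, Prop 2.53),
  cylinders are built from SATURATED BOREL subsets of `𝒮` (traces of `Σ`-ball-generated sets) and
  `{☠}` (R22); this class is closed under intersections and contains the preimages of the open sets of
  `𝔒̂`, so agreement on it is (at least) equality of the laws `π_*μ` as Borel measures on path space
  evaluated at finitely many times — the coupling proof of Thm 7.5 (ii) (`X ∼ X̄` pathwise) gives
  exactly this.
* (R23) **Constants.** Print's `Λ` uses `C^ε_𝔄 = C^ε_YM + Č` with `C^ε_YM` "determined by the BPHZ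
  character" (Rem. 1.8; typed existentially in `localExistence3D`) and `Č` the unique `χ`-independent
  operator of the gauge-covariance Theorem 1.9 (i) (not typed). Def. 7.2 is therefore typed with
  parameters `(CYM, C₀)`, and Thm 7.5 as: for every family `CYM` having the Theorem 1.7 property
  (`IsYMRenormalisation`) there is `C₀ ∈ L_G(𝔤,𝔤)` (print: `C₀ = Č`, shifted by the finite part of
  `CYM`) for which (i) and (ii) hold — the existence content of Thm 7.5; the identification of `Č` via
  gauge covariance (Thm 1.9 (i)) stays quoted. `Σ̄`: Def. 7.2 depends on the auxiliary parameters
  `(η̄, δ̄, ᾱ)` (Rem. 7.3: "due to technical issues with measurable selections"); they are explicit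
  parameters (`IsBarParams`, with "`β < −2(1−δ̄)−`" as `−2(1−δ̄) − ε₁ < β < −2(1−δ̄)`), universally
  quantified in the fact after `∃ ε₁ > 0`.
* (R24) "`π_*μ` is a probability measure on `C(ℝ_+, 𝔒̂)`": a.s., for every saturated `Σ`-open
  `U ⊆ 𝒮`, the set of times at which `X(t) ∈ U` is relatively open in `[0,∞)` (the only open set of
  `𝔒̂` containing `☠` is `𝔒̂`, Prop 2.53, so no condition at `☠`).

## Not transcribed

Thm 1.9 (i) / Thm 6.1 (gauge covariance in law, the characterisation of `Č`), Prop 7.6 (coupling),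
§7.2 (measurable selections, Thm 7.9), Rem 7.4; the Higgs field. The author-stated OPEN questions of
§1.2 — whether this Markov process has a (unique) invariant measure, which "would be a candidate for
the YMH measure on `𝕋³`", and whether `∼` is induced by a gauge group — are not Literature facts; this
file and `OrbitSpace3D.lean` give the vocabulary in which a planner can file them as conjecture leaves.
-/

noncomputable section

open MeasureTheory Filter Topology ProbabilityTheory
open scoped ENNReal NNReal

namespace Literature.MathematicalPhysics.QuantumFieldTheory.CCHS2024

/-! ### Borel structures, càdlàg paths, blow-up in `𝒮̂` -/

section HatState

variable {N : ℕ}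

/-- The σ-algebra on `𝒮̂ = 𝒮 ⊔ {☠}` generated by `{☠}` and the open `Σ`-balls (the Borel σ-algebra of
the metrisable space `𝒮̂`; `𝒮` is separable) (R18). [cite: ChandraEtAl2024, §7 Def. 7.2 (1) ("X(0) is 𝓕_0-measurable") with §2.6 (the metrisable space 𝒮̂ ≔ 𝒮 ∪ {☠})] -/
abbrev hatSigmaBorel3 (p : StateParams) : MeasurableSpace (Option (HeatDatum N)) :=
  MeasurableSpace.generateFrom
    ({{none}} ∪
      {S | ∃ (B : HeatDatum N) (ρ : ℝ),
        S = {x | ∃ h : HeatDatum N, x = some h ∧ sigmaDist p h B < ENNReal.ofReal ρ}})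

/-- The σ-algebra on heat data generated by the open `Σ`-balls (its trace on `𝒮` is the Borel
σ-algebra of `(𝒮, Σ)`) (R22). [cite: ChandraEtAl2024, §7 Thm 7.5 (ii) (P^z a probability measure on C(ℝ_+, 𝔒̂)) with §2.3 Def. 2.22 ((𝒮, Σ))] -/
abbrev sigmaBorel3 (p : StateParams) : MeasurableSpace (HeatDatum N) :=
  MeasurableSpace.generateFrom
    {S | ∃ (B : HeatDatum N) (ρ : ℝ), S = {h | sigmaDist p h B < ENNReal.ofReal ρ}}

/-- **`f ∈ D(ℝ_+, 𝒮̂)`** (read on `t ≥ 0`): right-continuous with left limits for the metric `d̂` of `𝒮̂`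
(`hatDist3`). [cite: ChandraEtAl2024, §7 Def. 7.1 ("D(ℝ_+,F) the usual Skorokhod space of càdlàg functions") and Def. 7.2 ("a D(ℝ_+,𝒮̂)-valued random variable X")] -/
def IsCadlagPath3 (p : StateParams) (f : ℝ → Option (HeatDatum N)) : Prop :=
  ∀ t : ℝ, 0 ≤ t →
    Tendsto (fun s => hatDist3 p (f s) (f t)) (𝓝[>] t) (𝓝 0) ∧
    (0 < t → ∃ y : Option (HeatDatum N), Tendsto (fun s => hatDist3 p (f s) y) (𝓝[<] t) (𝓝 0))

/-- `T*[f] = inf{t ≥ 0 : f(t) = ☠} ∈ [0,∞]`. [cite: ChandraEtAl2024, §7 Def. 7.2 (3) (T* ≔ inf{t ≥ 0 : X(t) = ☠})] -/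
def blowUpTime3 (f : ℝ → Option (HeatDatum N)) : ℝ≥0∞ :=
  ⨅ (t : ℝ) (_ : 0 ≤ t ∧ f t = none), ENNReal.ofReal t

/-- The value of a path at a possibly infinite time (`☠` at `∞`). [cite: ChandraEtAl2024, §7 Def. 7.2 (2) (X(ς_j), X(ς_{j+1}))] -/
def atTime3 (f : ℝ → Option (HeatDatum N)) (σ : WithTop ℝ) : Option (HeatDatum N) :=
  WithTop.recTopCoe none (fun s : ℝ => f s) σ

/-- `Σ(X,0)` on `𝒮̂`, `+∞` at `☠`. [cite: ChandraEtAl2024, §7 Def. 7.2 (3) (lim_{t↑T*} Σ(X(t),0) = ∞)] -/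
def hatSigmaSize (p : StateParams) (x : Option (HeatDatum N)) : ℝ≥0∞ :=
  x.elim ∞ fun h => sigmaDist p h 0

/-- The auxiliary parameters of `Σ̄ = Σ_{η̄,β,δ̄,ᾱ,θ}`: `η̄ ∈ (η,−½)`, `δ̄ ∈ (¾,δ)` with `β < −2(1−δ̄)`,
`ᾱ ∈ (α,½)`, the other parameters unchanged (R23; the "−" closeness is added in the fact).
[cite: ChandraEtAl2024, §7 Def. 7.1 ("Consider η̄ ∈ (η,−½), δ̄ ∈ (¾,δ) such that β < −2(1−δ̄)−, and ᾱ ∈ (α,½) … Denote Σ̄ ≡ Σ_{η̄,β,δ̄,ᾱ,θ}")] -/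
def IsBarParams (p pbar : StateParams) : Prop :=
  p.η < pbar.η ∧ pbar.η < -1 / 2 ∧ 3 / 4 < pbar.δ ∧ pbar.δ < p.δ ∧ p.β < -2 * (1 - pbar.δ) ∧
    p.α < pbar.α ∧ pbar.α < 1 / 2 ∧ pbar.β = p.β ∧ pbar.θ = p.θ ∧ pbar.ρ = p.ρ

variable {G : Type*} [Group G] [TopologicalSpace G] (r : LatticeRep G)

/-- The orbit relation on `𝒮̂`: `∼` on `𝒮` (`OrbitRel3`) and `X ∼ ☠ ⇔ X = ☠`.
[cite: ChandraEtAl2024, §7 Def. 7.1 ("We extend the relation ∼ to 𝒮̂ = 𝒮 ⊔ {☠} by imposing that X ∼ ☠ ⇔ X = ☠")] -/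
def HatOrbitRel3 (p : StateParams) (x y : Option (HeatDatum r.N)) : Prop :=
  x.elim (y = none) fun h => ∃ h' : HeatDatum r.N, y = some h' ∧ OrbitRel3 r p h h'

/-- `inf_{Y ∈ 𝒮, Y ∼ X} Σ̄(Y,0)` — the `Σ̄`-size of the orbit of `X ∈ 𝒮̂` (`+∞` at `☠`).
[cite: ChandraEtAl2024, §7 Def. 7.2 (3) (lim_{t↑T*} inf_{Y∈𝒮, Y∼X(t)} Σ̄(Y,0) = ∞) and Rem. 7.3] -/
def orbitInfSigma3 (p pbar : StateParams) (x : Option (HeatDatum r.N)) : ℝ≥0∞ :=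
  x.elim ∞ fun h => ⨅ y ∈ orbit3 r p h, sigmaDist pbar y 0

/-- A **saturated Borel subset of `𝒮`**: the trace on `𝒮` of a `Σ`-ball-generated measurable set, closed
under `∼` (the preimage under `π : 𝒮 → 𝔒` of a measurable subset of `𝔒`) (R22).
[cite: ChandraEtAl2024, §7 Thm 7.5 (ii) (π_*μ = P^z, P^z a probability measure on C(ℝ_+, 𝔒̂)) with §2.6 Def. 2.49] -/
def IsSaturatedBorel3 (p : StateParams) (S : Set (HeatDatum r.N)) : Prop :=
  (∃ V : Set (HeatDatum r.N), MeasurableSet[sigmaBorel3 p] V ∧ S = V ∩ stateSpace3 r p) ∧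
    ∀ x ∈ S, ∀ y ∈ stateSpace3 r p, OrbitRel3 r p x y → y ∈ S

/-- An elementary constraint on a point of `𝔒̂` seen on representatives: `none` = "is `☠`", `some S` =
"lies in the saturated set `S`". [cite: ChandraEtAl2024, §7 Thm 7.5 (ii)] -/
def InSatSet (x : Option (HeatDatum N)) (c : Option (Set (HeatDatum N))) : Prop :=
  c.elim (x = none) fun S => ∃ h : HeatDatum N, x = some h ∧ h ∈ S

variable {Ω : Type*}

/-- The cylinder event "`X(t_k)` satisfies the constraint `c_k` for all `k`" of the projected process
`πX` (R22). [cite: ChandraEtAl2024, §7 Thm 7.5 (ii)] -/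
def satCylinder {n : ℕ} (t : Fin n → ℝ) (c : Fin n → Option (Set (HeatDatum N)))
    (X : Ω → ℝ → Option (HeatDatum N)) : Set Ω :=
  {ω | ∀ k, InSatSet (X ω (t k)) (c k)}

end HatState

/-! ### White noise, admissible filtrations and the SYMH solution map `Λ` (Def. 7.1) -/

section SolutionMap

variable {N : ℕ} {Ω : Type*} [MeasurableSpace Ω]

/-- `𝒩_t` in 3D: the σ-algebra generated by the mollified noise fields `ζ^{χ,ε}_{i,n}(s,x)` which only
involve the white noise up to time `t` — `s + aε² ≤ t` whenever `χ` vanishes for `|time| ≥ a` (the 3D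
mollifier has compact support; its time-support radius `a` is carried as an index) (R17).
[cite: ChandraEtAl2024, §7 Def. 7.1 ("A filtration 𝔽 = (𝓕_t) is said to be admissible for ξ if ξ is adapted to 𝔽 …") with §1.3 (space-time mollifiers) and §1.4 (χ^ε(t,x) = ε⁻⁵χ(ε⁻²t,ε⁻¹x))] -/
abbrev noiseSigma3 (ζ : NoiseFamily3 N Ω) (t : ℝ) : MeasurableSpace Ω :=
  ⨆ (χ : SpaceTime3 → ℝ) (a : ℝ) (ε : ℝ) (z : SpaceTime3) (i : Fin 3) (n : NoiseIdx N)
    (_ : IsSpaceTimeMollifier3 χ ∧ (∀ w : SpaceTime3, a ≤ |w.1| → χ w = 0) ∧ 0 < ε ∧ ε ≤ 1 ∧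
      z.1 + a * ε ^ 2 ≤ t),
    MeasurableSpace.comap (fun ω => ζ χ ε ω z i n) (inferInstance : MeasurableSpace ℝ)

/-- `𝒩⁺_t` in 3D: the σ-algebra generated by the mollified noise fields which only involve the white
noise after time `t` (`s − aε² ≥ t`) (R17). [cite: ChandraEtAl2024, §7 Def. 7.1 ("… and ξ|_{[t,∞)} is independent of 𝓕_t for all t ≥ 0")] -/
abbrev futureNoiseSigma3 (ζ : NoiseFamily3 N Ω) (t : ℝ) : MeasurableSpace Ω :=
  ⨆ (χ : SpaceTime3 → ℝ) (a : ℝ) (ε : ℝ) (z : SpaceTime3) (i : Fin 3) (n : NoiseIdx N)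
    (_ : IsSpaceTimeMollifier3 χ ∧ (∀ w : SpaceTime3, a ≤ |w.1| → χ w = 0) ∧ 0 < ε ∧ ε ≤ 1 ∧
      t ≤ z.1 - a * ε ^ 2),
    MeasurableSpace.comap (fun ω => ζ χ ε ω z i n) (inferInstance : MeasurableSpace ℝ)

/-- **`(𝓕_t)` is admissible for the white noise** (through its mollifications, R8/R17): adapted
(`𝒩_t ≤ 𝓕_t`) with independent future (`𝒩⁺_t` independent of `𝓕_t`).
[cite: ChandraEtAl2024, §7 Def. 7.1 (admissible filtration)] -/
def IsAdmissibleFiltration3 (P : Measure Ω) (F : Filt Ω) (ζ : NoiseFamily3 N Ω) : Prop :=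
  (∀ t : ℝ, noiseSigma3 ζ t ≤ F t) ∧ ∀ t : ℝ, Indep (futureNoiseSigma3 ζ t) (F t) P

variable {G : Type*} [Group G] [TopologicalSpace G] (r : LatticeRep G)

/-- **The Theorem 1.7 property of a family `(C^{χ,ε}_YM)` of mass renormalisations** (pure YM; the body of
`localExistence3D` as a predicate on the family, R23): `C^{χ,ε}_YM ∈ L_G(𝔤,𝔤)`, and for every `C̊`,
every white noise, every `a ∈ 𝒮` and all mollifiers `χ₁, χ₂`, the mollified solutions of (1.14) with
`C^ε_𝔄 = C^{χ_k,ε}_YM + C̊` converge in probability in `𝒮^sol` to limits which coincide almost surely.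
[cite: ChandraEtAl2024, Thm 1.7 (i)–(ii), Rem. 1.8 and §7 Def. 7.1 (the SYMH solution map Λ)] -/
def IsYMRenormalisation (p : StateParams)
    (CYM : (SpaceTime3 → ℝ) → ℝ → (Matrix (Fin r.N) (Fin r.N) ℂ →ₗ[ℝ] Matrix (Fin r.N) (Fin r.N) ℂ)) :
    Prop :=
  (∀ (χ : SpaceTime3 → ℝ) (ε : ℝ), IsSpaceTimeMollifier3 χ → 0 < ε → ε ≤ 1 → CYM χ ε ∈ invariantOps r) ∧
  ∀ (Ω : Type) [MeasurableSpace Ω] (P : Measure Ω) [IsProbabilityMeasure P]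
    (ζ : NoiseFamily3 r.N Ω), IsMollifiedWhiteNoise3 r P ζ →
  ∀ C₀ ∈ invariantOps r, ∀ a ∈ stateSpace3 r p, ∀ (ψ : ℝ → ℝ), IsAdmissibleCutoff ψ →
  ∀ (χ₁ χ₂ : SpaceTime3 → ℝ), IsSpaceTimeMollifier3 χ₁ → IsSpaceTimeMollifier3 χ₂ →
  ∀ (X₁eps X₂eps : ℝ → Ω → ℝ → Option (HeatDatum r.N)),
    (∀ ε : ℝ, 0 < ε → ε ≤ 1 → ∀ᵐ ω ∂P,
      IsSYMSolutionPath3 r p (CYM χ₁ ε + C₀) (matrixNoise3 r ζ χ₁ ε ω) a (X₁eps ε ω) ∧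
      IsSYMSolutionPath3 r p (CYM χ₂ ε + C₀) (matrixNoise3 r ζ χ₂ ε ω) a (X₂eps ε ω)) →
    ∃ X₁ X₂ : Ω → ℝ → Option (HeatDatum r.N),
      (∀ᵐ ω ∂P, IsSolPath3 p r (X₁ ω) ∧ IsSolPath3 p r (X₂ ω)) ∧
      (∀ η₁ : ℝ, 0 < η₁ →
        Tendsto (fun ε : ℝ => P {ω | η₁ < solDist3 p ψ (X₁eps ε ω) (X₁ ω)}) (𝓝[>] 0) (𝓝 0) ∧
        Tendsto (fun ε : ℝ => P {ω | η₁ < solDist3 p ψ (X₂eps ε ω) (X₂ ω)}) (𝓝[>] 0) (𝓝 0)) ∧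
      ∀ᵐ ω ∂P, solDist3 p ψ (X₁ ω) (X₂ ω) = 0

/-- **`Θ = Λ_{σ,σ+·}(B)`, the SYMH solution map at random data (R16).** For a random time `σ ∈ [0,∞]`
and a random datum `B ∈ 𝒮̂`: a.s. `Θ ≡ ☠` where `σ = ∞` or `B = ☠`, a.s. `Θ ∈ 𝒮^sol` otherwise, and every
version `X^ε` of the maximal classical solutions of (1.14) with `C^ε_𝔄 = C^{χ,ε}_YM + C₀` driven by the
noise restarted at time `σ`, from `B`, converges to `Θ` in probability in `(𝒮^sol, D)` as `ε ↓ 0`.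
[cite: ChandraEtAl2024, §7 Def. 7.1 ("By the SYMH solution map (driven by ξ) we mean the random flow Λ … obtained as the ε → 0 limit of (1.14)") with Thm 1.7] -/
def IsLimitFlowFrom3 (p : StateParams)
    (CYM : (SpaceTime3 → ℝ) → ℝ → (Matrix (Fin r.N) (Fin r.N) ℂ →ₗ[ℝ] Matrix (Fin r.N) (Fin r.N) ℂ))
    (C₀ : Matrix (Fin r.N) (Fin r.N) ℂ →ₗ[ℝ] Matrix (Fin r.N) (Fin r.N) ℂ)
    (P : Measure Ω) (ζ : NoiseFamily3 r.N Ω) (χ : SpaceTime3 → ℝ)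
    (σ : Ω → WithTop ℝ) (B : Ω → Option (HeatDatum r.N)) (Θ : Ω → ℝ → Option (HeatDatum r.N)) :
    Prop :=
  (∀ᵐ ω ∂P, (σ ω = ⊤ ∨ B ω = none) → ∀ t : ℝ, 0 ≤ t → Θ ω t = none) ∧
  (∀ᵐ ω ∂P, σ ω ≠ ⊤ → B ω ≠ none → IsSolPath3 p r (Θ ω)) ∧
  ∀ X : ℝ → Ω → ℝ → Option (HeatDatum r.N),
    (∀ ε : ℝ, 0 < ε → ε ≤ 1 → ∀ᵐ ω ∂P, ∀ (s : ℝ) (b : HeatDatum r.N),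
        σ ω = (s : WithTop ℝ) → B ω = some b →
        IsSYMSolutionPath3 r p (CYM χ ε + C₀)
          (fun z : SpaceTime3 => matrixNoise3 r ζ χ ε ω (s + z.1, z.2)) b (X ε ω)) →
    ∀ ψ : ℝ → ℝ, IsAdmissibleCutoff ψ → ∀ δ : ℝ, 0 < δ →
      Tendsto (fun ε : ℝ => P {ω | σ ω ≠ ⊤ ∧ B ω ≠ none ∧ δ < solDist3 p ψ (X ε ω) (Θ ω)})
        (𝓝[>] 0) (𝓝 0)

end SolutionMap

/-! ### Definition 7.2 (generative) -/

section Generative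

variable {G : Type*} [Group G] [TopologicalSpace G] (r : LatticeRep G)
variable {Ω : Type*} [MeasurableSpace Ω]

/-- **Definition 7.2 (generative), for the process.** `X : 𝒪 → D(ℝ_+, 𝒮̂)` on the filtered probability
space `(𝒪, 𝓕, (𝓕_t), P)` carrying the white noise (through `ζ`, R8), with state-space parameters `p`,
auxiliary `Σ̄`-parameters `p̄`, and SYMH solution map `Λ` built from `(C^{χ,ε}_YM, C₀)` (R23), is
*generative* if `(𝓕_t)` is admissible, a.s. `X ∈ D(ℝ_+, 𝒮̂)`, and: (1) `X(0)` is `𝓕_0`-measurable;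
(2) for some mollifier `χ` (the solution map is independent of it) there are non-decreasing stopping
times `ς_0 = 0 ≤ ς_1 ≤ ⋯ ≤ ∞` with, for all `j`, (a) `X(t) = Λ_{ς_j,t}(X(ς_j))` for `t ∈ [ς_j,ς_{j+1})` and
(b) `X(ς_{j+1})` `𝓕_{ς_{j+1}}`-measurable and `X(ς_{j+1}) ∼ Λ_{ς_j,ς_{j+1}}(X(ς_j))`; (3) with
`T* = inf{t ≥ 0 : X(t) = ☠}`: a.s. `ς_j → T*`, and if `T* < ∞`: `X ≡ ☠` on `[T*,∞)`,
`lim_{t↑T*} Σ(X(t),0) = ∞` and `lim_{t↑T*} inf_{Y∈𝒮, Y∼X(t)} Σ̄(Y,0) = ∞`.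
[cite: ChandraEtAl2024, §7 Def. 7.2 (def:gen, items (1)–(3)) with Def. 7.1 and Rem. 7.3] -/
def IsGenerative3 (p pbar : StateParams)
    (CYM : (SpaceTime3 → ℝ) → ℝ → (Matrix (Fin r.N) (Fin r.N) ℂ →ₗ[ℝ] Matrix (Fin r.N) (Fin r.N) ℂ))
    (C₀ : Matrix (Fin r.N) (Fin r.N) ℂ →ₗ[ℝ] Matrix (Fin r.N) (Fin r.N) ℂ)
    (P : Measure Ω) (F : Filt Ω) (ζ : NoiseFamily3 r.N Ω) (X : Ω → ℝ → Option (HeatDatum r.N)) : Prop :=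
  IsMollifiedWhiteNoise3 r P ζ ∧ IsAdmissibleFiltration3 P F ζ ∧
  -- `X` is a `D(ℝ_+, 𝒮̂)`-valued random variable
  (∀ᵐ ω ∂P, IsCadlagPath3 p (X ω) ∧
    ∀ t : ℝ, 0 ≤ t → ∀ h : HeatDatum r.N, X ω t = some h → h ∈ stateSpace3 r p) ∧
  -- (1) `X(0)` is `𝓕_0`-measurable
  Measurable[F 0, hatSigmaBorel3 p] (fun ω => X ω 0) ∧
  ∃ χ : SpaceTime3 → ℝ, IsSpaceTimeMollifier3 χ ∧
  ∃ (σ : ℕ → Ω → WithTop ℝ) (Θ : ℕ → Ω → ℝ → Option (HeatDatum r.N)),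
    -- (2) stopping times `ς_0 = 0 ≤ ς_1 ≤ ⋯`
    (∀ j, IsStoppingTime F (σ j)) ∧
    (∀ᵐ ω ∂P, σ 0 ω = ((0 : ℝ) : WithTop ℝ) ∧ Monotone fun j => σ j ω) ∧
    (∀ j : ℕ,
      -- `Θ_j = Λ_{ς_j, ς_j + ·}(X(ς_j))`
      IsLimitFlowFrom3 r p CYM C₀ P ζ χ (σ j) (fun ω => atTime3 (X ω) (σ j ω)) (Θ j) ∧
      -- (2a) `X(t) = Λ_{ς_j,t}(X(ς_j))` for `ς_j ≤ t < ς_{j+1}`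
      (∀ᵐ ω ∂P, ∀ s t : ℝ, σ j ω = (s : WithTop ℝ) → s ≤ t → (t : WithTop ℝ) < σ (j + 1) ω →
        X ω t = Θ j ω (t - s)) ∧
      -- (2b) `X(ς_{j+1})` is `𝓕_{ς_{j+1}}`-measurable and `X(ς_{j+1}) ∼ Λ_{ς_j,ς_{j+1}}(X(ς_j))`
      (∃ h : IsStoppingTime F (σ (j + 1)),
        Measurable[h.measurableSpace, hatSigmaBorel3 p] (fun ω => atTime3 (X ω) (σ (j + 1) ω))) ∧
      (∀ᵐ ω ∂P, ∀ s u : ℝ, σ j ω = (s : WithTop ℝ) → σ (j + 1) ω = (u : WithTop ℝ) →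
        HatOrbitRel3 r p (Θ j ω (u - s)) (X ω u))) ∧
    -- (3) honest blow-up
    (∀ᵐ ω ∂P,
      Tendsto (fun j => topToENNReal (σ j ω)) atTop (𝓝 (blowUpTime3 (X ω))) ∧
      (blowUpTime3 (X ω) < ∞ →
        (∀ t : ℝ, 0 ≤ t → blowUpTime3 (X ω) ≤ ENNReal.ofReal t → X ω t = none) ∧
        (0 < blowUpTime3 (X ω) →
          Tendsto (fun t : ℝ => hatSigmaSize p (X ω t)) (𝓝[<] (blowUpTime3 (X ω)).toReal) (𝓝 ∞) ∧
          Tendsto (fun t : ℝ => orbitInfSigma3 r p pbar (X ω t))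
            (𝓝[<] (blowUpTime3 (X ω)).toReal) (𝓝 ∞))))

end Generative

/-! ### Theorem 7.5 -/

section Theorems

/-- **Theorem 7.5 (the Markov process on gauge orbits in 3D; announced as Thm 1.9 (ii)), pure YM.** In
the parameter regime of §5 (R15), for admissible auxiliary parameters `p̄` of `Σ̄` (R23) and for every
family `C^{χ,ε}_YM` with the Theorem 1.7 property, there is `C₀ ∈ L_G(𝔤,𝔤)` (print: the unique
gauge-covariant choice `Č`) such that: **(i)** for every `x ∈ 𝒮̂` there exists a generative probability
measure with initial condition `x` (a filtered probability space, a white noise with admissible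
filtration and a generative process `X` with `X(0) = x`); **(ii)** (a) `π_*μ` depends only on the orbit
of the initial condition: two generative processes with initial conditions `x ∼ x̄` have projected
processes with the same law (all saturated-Borel cylinder probabilities agree, R22) — this defines
`P^z`, `z = [x]`; (b) a.s. the projected path is continuous in `𝔒̂` (R24); (c) `{P^z}_{z∈𝔒̂}` are the
transition functions of a time-homogeneous Markov process on `𝔒̂`: `P(E ∩ Γ) = ∫_E P^{[X(s)]}(Γ) dP`
for past cylinders `E`, future cylinders `Γ` at times `s + t_k`, with `P^{[b]}` computed from any
generative process started at `b`.
[cite: ChandraEtAl2024, §7 Thm 7.5 (thm:Markov_process, (i)–(ii)) with Def. 7.1, Def. 7.2, the paragraph preceding Thm 7.5 (π_*μ is a probability measure on C(ℝ_+, 𝔒̂)), Prop. 2.53; Thm 1.9 (ii)] -/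
def markovProcessOnOrbits3D : Prop :=
  ∀ (G : Type) [Group G] [TopologicalSpace G] [CompactSpace G] (r : LatticeRep G) (δ : ℝ),
    3 / 4 < δ → δ < 1 →
    ∃ ε₀ : ℝ, 0 < ε₀ ∧ ∀ p : StateParams, p.δ = δ → printedRegime p → nearCorner ε₀ p →
    ∃ ε₁ : ℝ, 0 < ε₁ ∧ ∀ pbar : StateParams, IsBarParams p pbar → -2 * (1 - pbar.δ) - ε₁ < p.β →
    ∀ CYM : (SpaceTime3 → ℝ) → ℝ → (Matrix (Fin r.N) (Fin r.N) ℂ →ₗ[ℝ] Matrix (Fin r.N) (Fin r.N) ℂ),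
      IsYMRenormalisation r p CYM →
    ∃ C₀ : Matrix (Fin r.N) (Fin r.N) ℂ →ₗ[ℝ] Matrix (Fin r.N) (Fin r.N) ℂ, C₀ ∈ invariantOps r ∧
      -- (i) existence of generative measures from every `x ∈ 𝒮̂`
      (∀ x : Option (HeatDatum r.N), (∀ h : HeatDatum r.N, x = some h → h ∈ stateSpace3 r p) →
        ∃ (Ω : Type) (_ : MeasurableSpace Ω) (P : Measure Ω) (_ : IsProbabilityMeasure P)
          (F : Filt Ω) (ζ : NoiseFamily3 r.N Ω) (X : Ω → ℝ → Option (HeatDatum r.N)),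
          IsGenerative3 r p pbar CYM C₀ P F ζ X ∧ ∀ᵐ ω ∂P, X ω 0 = x) ∧
      -- (ii)(a) `π_*μ` depends only on the orbit of the initial condition
      (∀ (Ω : Type) [MeasurableSpace Ω] (P : Measure Ω) [IsProbabilityMeasure P] (F : Filt Ω)
          (ζ : NoiseFamily3 r.N Ω) (X : Ω → ℝ → Option (HeatDatum r.N)) (x : Option (HeatDatum r.N))
          (Ω' : Type) [MeasurableSpace Ω'] (P' : Measure Ω') [IsProbabilityMeasure P'] (F' : Filt Ω')
          (ζ' : NoiseFamily3 r.N Ω') (X' : Ω' → ℝ → Option (HeatDatum r.N)) (x' : Option (HeatDatum r.N)),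
        IsGenerative3 r p pbar CYM C₀ P F ζ X → (∀ᵐ ω ∂P, X ω 0 = x) →
        IsGenerative3 r p pbar CYM C₀ P' F' ζ' X' → (∀ᵐ ω ∂P', X' ω 0 = x') →
        HatOrbitRel3 r p x x' →
        ∀ (n : ℕ) (t : Fin n → ℝ) (c : Fin n → Option (Set (HeatDatum r.N))),
          (∀ k, 0 ≤ t k) → (∀ (k : Fin n) (S : Set (HeatDatum r.N)), c k = some S → IsSaturatedBorel3 r p S) →
          P (satCylinder t c X) = P' (satCylinder t c X')) ∧
      -- (ii)(b) a.s. the projected path is continuous in the quotient topology of `𝔒̂`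
      (∀ (Ω : Type) [MeasurableSpace Ω] (P : Measure Ω) [IsProbabilityMeasure P] (F : Filt Ω)
          (ζ : NoiseFamily3 r.N Ω) (X : Ω → ℝ → Option (HeatDatum r.N)),
        IsGenerative3 r p pbar CYM C₀ P F ζ X →
        ∀ᵐ ω ∂P, ∀ U : Set (HeatDatum r.N), U ⊆ stateSpace3 r p →
          (∀ a ∈ U, ∀ b ∈ stateSpace3 r p, OrbitRel3 r p a b → b ∈ U) →
          (∀ a ∈ U, ∃ ε : ℝ, 0 < ε ∧ ∀ b ∈ stateSpace3 r p, sigmaDist p a b < ENNReal.ofReal ε → b ∈ U) →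
          ∀ t₀ : ℝ, 0 ≤ t₀ → (∃ h ∈ U, X ω t₀ = some h) →
            ∃ ε : ℝ, 0 < ε ∧ ∀ t : ℝ, 0 ≤ t → |t - t₀| < ε → ∃ h ∈ U, X ω t = some h) ∧
      -- (ii)(c) `{P^z}` are the transition functions of a time-homogeneous Markov process on `𝔒̂`
      (∀ (Ω : Type) [MeasurableSpace Ω] (P : Measure Ω) [IsProbabilityMeasure P] (F : Filt Ω)
          (ζ : NoiseFamily3 r.N Ω) (X : Ω → ℝ → Option (HeatDatum r.N)) (x : Option (HeatDatum r.N))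
          (Ωf : Option (HeatDatum r.N) → Type) [∀ b, MeasurableSpace (Ωf b)]
          (Pf : ∀ b, Measure (Ωf b)) [∀ b, IsProbabilityMeasure (Pf b)] (Ff : ∀ b, Filt (Ωf b))
          (ζf : ∀ b, NoiseFamily3 r.N (Ωf b)) (Xf : ∀ b, Ωf b → ℝ → Option (HeatDatum r.N)),
        IsGenerative3 r p pbar CYM C₀ P F ζ X → (∀ᵐ ω ∂P, X ω 0 = x) →
        (∀ b : Option (HeatDatum r.N), (∀ h : HeatDatum r.N, b = some h → h ∈ stateSpace3 r p) →
          IsGenerative3 r p pbar CYM C₀ (Pf b) (Ff b) (ζf b) (Xf b) ∧ ∀ᵐ ω ∂(Pf b), Xf b ω 0 = b) →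
        ∀ (s : ℝ), 0 ≤ s →
        ∀ (m : ℕ) (u : Fin m → ℝ) (cu : Fin m → Option (Set (HeatDatum r.N))),
          (∀ k, 0 ≤ u k ∧ u k ≤ s) →
          (∀ (k : Fin m) (S : Set (HeatDatum r.N)), cu k = some S → IsSaturatedBorel3 r p S) →
        ∀ (n : ℕ) (t : Fin n → ℝ) (ct : Fin n → Option (Set (HeatDatum r.N))),
          (∀ k, 0 ≤ t k) →
          (∀ (k : Fin n) (S : Set (HeatDatum r.N)), ct k = some S → IsSaturatedBorel3 r p S) →
          P (satCylinder u cu X ∩ satCylinder (fun k => s + t k) ct X) =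
            ∫⁻ ω in satCylinder u cu X, (Pf (X ω s)) (satCylinder t ct (Xf (X ω s))) ∂P)

end Theorems

end Literature.MathematicalPhysics.QuantumFieldTheory.CCHS2024
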